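import Summits.ResolutionOfSingularities.ResolutionOfSingularities.Theorems.FrobeniusLadderFInjectiveMacaulayficationFTemkinClosedPoints
import Summits.ResolutionOfSingularities.ResolutionOfSingularities.Theorems.FrobeniusLadderFInjectiveMacaulayficationLocalFullificationDimFour
import Summits.ResolutionOfSingularities.ResolutionOfSingularities.Theorems.FrobeniusLadderFInjectiveMacaulayficationRegularBlowupModelDim2
import HarnessLib

/-!
# (GU) A UNIVERSALLY FULL CENTRE on a fourfold, modulo (L4): one ideal sheaf `J ≠ ⊥`, supported in `Sing X` and containing every
# non-FULL point, ALL of whose blowings up are FULL at EVERY point (crux `FInjectiveMacaulayfication` stmt-ResolutionOfSingularities-15315,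
# chain w45a; res-L1-w45a-plan-1 RULING R17.1 (β), input of door v35's dim-4 cores; seat res-L1-w45a-stub-3 g7)

[OURS · L1 W4.5a] Support file (`--supports stmt-ResolutionOfSingularities-15315 --as helper`); NOT a statement of any manuscript; def-free;
CONDITIONAL on {CP 2019 Thm. 1.1 (i)(ii), Raynaud–Gruson 5.2.2, CP 2019 Prop. 4.4} BY NAME and on the chain's CANDIDATE (L4)
`LocalFullificationDimFour.LocalFullificationDimFour` (p583849, consumed as a hypothesis). AI-written (AI review is weaker than expert review).

* **`exists_isBlowup_fullCentre_of_L4 (hG h081R hP) (hL4) … (h4 : topologicalKrullDim X = 4)`**: for an integral separated finite-type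
  fourfold `X/k` there is `J ≠ ⊥` with `Supp J ⊆ (Reg X)ᶜ`, `{x | ¬ FULL(𝒪_{X,x})} ⊆ Supp J`, and EVERY blowing up `π' : X' → X` along `J`
  FULL at EVERY point of `X'`. Source: `FTemkinClosedPoints.exists_isBlowup_full_of_L4` (one FULL blow-up model `X'' → X` along `J`);
  universality by uniqueness of blowing up (`IsBlowup.unique`: `X' ≅ X''` over `X`, stalks transported); the third conjunct because off
  `Supp J` the blowing up is a local isomorphism (`RegularBlowupModelDim2.exists_preimage_of_isBlowup_of_not_mem`,
  `isIso_stalkMap_of_isBlowup_of_not_mem`), so `X` is FULL there already.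
[folklore assembly; cite: StacksProject, Tag 085U (uniqueness of blowing up); Tag 02OS] [cite: Temkin2008, Prop. 2.3.4] [cite: CossartPiltant2019, Thm. 1.1 (i)(ii); Prop. 4.4]
-/

-- single-problem summit: the doubled namespace component is forced
set_option linter.dupNamespace false

noncomputable section

namespace Summit.ResolutionOfSingularities.ResolutionOfSingularities.Theorems.FInjectiveMacaulayfication.GoodOverUnivOfL4

open CategoryTheory CategoryTheory.Limits AlgebraicGeometry TopologicalSpace IsLocalRing
open Literature.AlgebraicGeometry.Resolution
open Summit.ResolutionOfSingularities.ResolutionOfSingularities.Theorems.FInjectiveMacaulayfication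
open SliceableCentre

/-- **(GU) The universally FULL centre of a fourfold, modulo (L4) and the threefold package.** See the module docstring.
[OURS · conditional-result] [cite: StacksProject, Tag 085U; Tag 02OS] [cite: Temkin2008, Prop. 2.3.4] [cite: CossartPiltant2019, Thm. 1.1 (i)(ii); Prop. 4.4] -/
theorem exists_isBlowup_fullCentre_of_L4
    (hG : CossartPiltant2019General.{0}) (h081R : Stacks081R.{0}) (hP : CossartPiltant2019Principalization.{0})
    (hL4 : LocalFullificationDimFour.LocalFullificationDimFour)
    (p : ℕ) (hp : p.Prime) (k : Type) [Field k] [CharP k p] (X : Scheme.{0}) (f₀ : X ⟶ Spec (.of k))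
    [IsSeparated f₀] [LocallyOfFiniteType f₀] [QuasiCompact f₀] [IsIntegral X] (h4 : topologicalKrullDim X = 4) :
    ∃ J : X.IdealSheafData, J ≠ ⊥ ∧ (J.support : Set X) ⊆ (Scheme.regularLocus X)ᶜ ∧
      (∀ x : X, ¬ FullCl p (X.presheaf.stalk x) → x ∈ (J.support : Set X)) ∧
      ∀ (X' : Scheme.{0}) (π' : X' ⟶ X), IsBlowup π' J → ∀ x' : X', FullCl p (X'.presheaf.stalk x') := by
  obtain ⟨X'', f'', J, hf'', hJne, hJ, hfull⟩ :=
    FTemkinClosedPoints.exists_isBlowup_full_of_L4 (fun q hq => hL4 q hq) hG h081R hP p hp k X f₀ h4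
  refine ⟨J, hJne, hJ, fun x hx => ?_, fun X' π' hπ' x' => ?_⟩
  · -- off `Supp J` the blowing up `f''` is a local isomorphism, so `X` is FULL there
    by_contra hxJ
    obtain ⟨x'', hx''⟩ := RegularBlowupModelDim2.exists_preimage_of_isBlowup_of_not_mem hf'' x hxJ
    haveI := RegularBlowupModelDim2.isIso_stalkMap_of_isBlowup_of_not_mem hf'' x'' (hx''.symm ▸ hxJ)
    apply hx
    have h := FTemkinClosedPoints.fullCl_of_isIso_stalkMap p f'' x'' (hfull x'')
    rwa [show f'' x'' = x from hx''] at h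
  · -- uniqueness of blowing up: `X' ≅ X''` over `X`
    obtain ⟨e, -, -⟩ := hπ'.unique hf''
    exact FTemkinClosedPoints.fullCl_of_isIso_stalkMap' p e.hom x' (hfull (e.hom x'))

/-- (GU), blowing-ups-along-`J` form of the crux's model property: every blowing up along the centre is a proper birational INTEGRAL model
FULL at every point. [OURS · conditional-result] [cite: StacksProject, Tag 085U] -/
theorem fullModel_of_isBlowup_fullCentre
    (p : ℕ) {X : Scheme.{0}} [IsIntegral X] [IsLocallyNoetherian X] {J : X.IdealSheafData} (hJne : J ≠ ⊥)
    (hJfull : ∀ (X' : Scheme.{0}) (π' : X' ⟶ X), IsBlowup π' J → ∀ x' : X', FullCl p (X'.presheaf.stalk x'))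
    {X' : Scheme.{0}} (π' : X' ⟶ X) (hπ' : IsBlowup π' J) :
    IsProper π' ∧ IsBirational π' ∧ IsIntegral X' ∧ ∀ x' : X', FullCl p (X'.presheaf.stalk x') :=
  ⟨hπ'.isProper, hπ'.isBirational' hJne, hπ'.isIntegral hJne, hJfull X' π' hπ'⟩

end Summit.ResolutionOfSingularities.ResolutionOfSingularities.Theorems.FInjectiveMacaulayfication.GoodOverUnivOfL4

end
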